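import Summits.QuantumAdvantage.QuantumAdvantage.Theses.LinnikCubicClassGroups
import Literature.Computability.Cryptography.HallgrenClassGroupGeneration

/-!
# Crux `LinnikCubicClassGroups.PureCubicClassGroupFBQP` (stmt-QuantumAdvantage-11544)
# — stub `stub_generation`

Line `arakelov-giant-step-cycle`, stub S4b (GENERATION). From the elementary facts about pure cubic
fields (stub S4a, taken as the first hypothesis) and the route hypothesis `DegreeOnePrimesEscape`
at `n = 3` we derive, for `X ≥ (27 m²)^C` (`C = max C₃ 4`):
* DENSITY: the good primes `p ≤ X`, `p ∤ 3m` number at least `X / (4 (⌊log₂ X⌋ + 1))`. This is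
  Chebyshev's bound in the elementary form `2^X ≤ (X+1) · lcm(1..X) ≤ (X+1) · X^{π(X)}`
  (Mathlib `Chebyshev.two_pow_le_mul_lcmUpto`), i.e. `X ≤ (⌊log₂ X⌋ + 1)(π(X) + 1)`.
* GENERATION: for `T ≥ 600 (⌊log₂ X⌋ + 1)²` all but a fraction `≤ 1/8` of the `T`-tuples of good
  primes have the property that the classes of all degree-one primes above them generate the class
  group. Union bound over the proper subgroup `H` generated (there are `≤ (h+1)^{⌊log₂ h⌋}`
  subgroups, `Hallgren2005.card_subgroup_le`); for each proper `H` the escape count of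
  `DegreeOnePrimesEscape` (`π(X) ≤ 8 · #{P : N P prime ≤ X, [P] ∉ H}`), at most `3` prime ideals of
  each prime norm, and at most `3m` primes dividing `3m` show that at least `N/25` of the `N` good
  primes escape `H`; finally `8 · (h+1)^{⌊log₂ h⌋} · (24/25)^T ≤ 1` by `2 · 24^18 ≤ 25^18` and
  `h ≤ (27m²)^10`.
-/

namespace Summit.QuantumAdvantage.QuantumAdvantage.Theorems.LinnikCubicClassGroups

open scoped NumberField
open Summit.QuantumAdvantage.QuantumAdvantage.Theses.LinnikCubicClassGroups (DegreeOnePrimesEscape)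

/-! ## Elementary arithmetic -/

/-- Chebyshev's lower bound for `π` in natural-number form: `X ≤ (⌊log₂ X⌋ + 1) · (π(X) + 1)`,
from `2^X ≤ (X+1) · lcm(1, …, X)` and `lcm(1, …, X) = ∏_{p ≤ X} p^{⌊log_p X⌋} ≤ X^{π(X)}`. -/
theorem le_log_succ_mul_primeCounting_succ (X : ℕ) :
    X ≤ (Nat.log 2 X + 1) * (Nat.primeCounting X + 1) := by
  rcases Nat.eq_zero_or_pos X with rfl | hX
  · simp
  have h1 : Nat.lcmUpto X ≤ X ^ Nat.primeCounting X := by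
    rw [Nat.lcmUpto_eq_prod_pow_log, ← Nat.primesLE_card_eq_primeCounting]
    exact Finset.prod_le_pow_card _ _ _ fun p _ => Nat.pow_log_le_self p hX.ne'
  have h2 : X + 1 ≤ 2 ^ (Nat.log 2 X + 1) := Nat.lt_pow_succ_log_self one_lt_two X
  have h3 : 2 ^ X ≤ 2 ^ ((Nat.log 2 X + 1) * (Nat.primeCounting X + 1)) :=
    calc 2 ^ X ≤ (X + 1) * Nat.lcmUpto X := Chebyshev.two_pow_le_mul_lcmUpto X
      _ ≤ 2 ^ (Nat.log 2 X + 1) * (2 ^ (Nat.log 2 X + 1)) ^ Nat.primeCounting X :=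
          Nat.mul_le_mul h2
            (h1.trans (Nat.pow_le_pow_left (Nat.le_of_lt_succ (Nat.lt_succ_of_lt h2)) _))
      _ = 2 ^ ((Nat.log 2 X + 1) * (Nat.primeCounting X + 1)) := by ring
  exact (Nat.pow_le_pow_iff_right (by norm_num)).mp h3

/-- `(n + 7)² ≤ 2^(n + 6)`. -/
theorem succ_sq_le_two_pow_aux (n : ℕ) : (n + 7) * (n + 7) ≤ 2 ^ (n + 6) := by
  induction n with
  | zero => norm_num
  | succ n ih =>
    rw [show n + 1 + 6 = (n + 6) + 1 from by ring, pow_succ]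
    nlinarith [ih]

/-- `(L + 1)² ≤ 2^L` for `L ≥ 6`. -/
theorem succ_sq_le_two_pow {L : ℕ} (hL : 6 ≤ L) : (L + 1) * (L + 1) ≤ 2 ^ L := by
  obtain ⟨n, rfl⟩ := Nat.exists_eq_add_of_le' hL
  exact succ_sq_le_two_pow_aux n

/-- `2^e · 24^(18 e + r) ≤ 25^(18 e + r)`, from `2 · 24^18 ≤ 25^18`. -/
theorem two_pow_mul_pow_le (e r : ℕ) : 2 ^ e * 24 ^ (18 * e + r) ≤ 25 ^ (18 * e + r) := by
  have h18 : 2 * 24 ^ 18 ≤ 25 ^ 18 := by norm_num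
  calc 2 ^ e * 24 ^ (18 * e + r) = (2 * 24 ^ 18) ^ e * 24 ^ r := by
        rw [pow_add, pow_mul, mul_pow, mul_assoc]
    _ ≤ (25 ^ 18) ^ e * 25 ^ r :=
        Nat.mul_le_mul (Nat.pow_le_pow_left h18 e) (Nat.pow_le_pow_left (by norm_num) r)
    _ = 25 ^ (18 * e + r) := by rw [pow_add, pow_mul]

/-- The union-bound arithmetic: `8 · (h+1)^{⌊log₂ h⌋} · 24^T ≤ 25^T` once
`18 · (3 + (⌊log₂ h⌋ + 1) ⌊log₂ h⌋) ≤ T`. -/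
theorem eight_mul_pow_log_mul_pow_le (h T : ℕ)
    (hT : 18 * (3 + (Nat.log 2 h + 1) * Nat.log 2 h) ≤ T) :
    8 * (h + 1) ^ Nat.log 2 h * 24 ^ T ≤ 25 ^ T := by
  have h1 : h + 1 ≤ 2 ^ (Nat.log 2 h + 1) := Nat.lt_pow_succ_log_self one_lt_two h
  have h2 : 8 * (h + 1) ^ Nat.log 2 h ≤ 2 ^ (3 + (Nat.log 2 h + 1) * Nat.log 2 h) :=
    calc 8 * (h + 1) ^ Nat.log 2 h ≤ 8 * (2 ^ (Nat.log 2 h + 1)) ^ Nat.log 2 h :=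
          Nat.mul_le_mul_left _ (Nat.pow_le_pow_left h1 _)
      _ = 2 ^ (3 + (Nat.log 2 h + 1) * Nat.log 2 h) := by ring
  obtain ⟨r, hr⟩ := Nat.exists_eq_add_of_le hT
  rw [hr]
  exact (Nat.mul_le_mul_right _ h2).trans (two_pow_mul_pow_le _ _)

/-- The exponent bound: if `h ≤ B^10`, `3 ⌊log₂ B⌋ ≤ L`, `1 ≤ ⌊log₂ B⌋` and `600 (L+1)² ≤ T` then
`18 · (3 + (⌊log₂ h⌋ + 1) ⌊log₂ h⌋) ≤ T`. -/
theorem exponent_le {h B L T : ℕ} (hB : B ≠ 0) (hh : h ≤ B ^ 10) (hL : 3 * Nat.log 2 B ≤ L)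
    (hb : 1 ≤ Nat.log 2 B) (hT : 600 * (L + 1) ^ 2 ≤ T) :
    18 * (3 + (Nat.log 2 h + 1) * Nat.log 2 h) ≤ T := by
  have h1 : Nat.log 2 h ≤ 10 * Nat.log 2 B + 9 := by
    have hlt : B ^ 10 < 2 ^ (10 * Nat.log 2 B + 10) :=
      calc B ^ 10 < (2 ^ (Nat.log 2 B + 1)) ^ 10 :=
            Nat.pow_lt_pow_left (Nat.lt_pow_succ_log_self one_lt_two B) (by norm_num)
        _ = 2 ^ (10 * Nat.log 2 B + 10) := by ring
    have := Nat.log_lt_of_lt_pow (pow_ne_zero 10 hB) hlt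
    have := Nat.log_mono_right (b := 2) hh
    omega
  have h2 : (Nat.log 2 h + 1) * Nat.log 2 h ≤ (10 * Nat.log 2 B + 10) * (10 * Nat.log 2 B + 9) :=
    Nat.mul_le_mul (by omega) h1
  have h3 : (3 * Nat.log 2 B + 1) ^ 2 ≤ (L + 1) ^ 2 := Nat.pow_le_pow_left (by omega) 2
  nlinarith [h2, h3, hb]

/-! ## Counting good primes and escaping primes -/

/-- The good primes `p ≤ X`, `p ∤ 3m` are among the `π(X)` primes `≤ X`, and all but at most `3m`
of those primes are good (`m ≠ 0`). -/
theorem card_goodPrimes (X m : ℕ) (hm : m ≠ 0) :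
    Nat.card {p : ℕ // p.Prime ∧ p ≤ X ∧ ¬ p ∣ 3 * m} ≤ Nat.primeCounting X ∧
    Nat.primeCounting X ≤ Nat.card {p : ℕ // p.Prime ∧ p ≤ X ∧ ¬ p ∣ 3 * m} + 3 * m := by
  classical
  have hS : Nat.card {p : ℕ // p.Prime ∧ p ≤ X ∧ ¬ p ∣ 3 * m} =
      ((Nat.primesLE X).filter (fun p => ¬ p ∣ 3 * m)).card :=
    Nat.subtype_card _ (fun p => by simp only [Finset.mem_filter, Nat.mem_primesLE]; tauto)
  rw [hS, ← Nat.primesLE_card_eq_primeCounting]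
  refine ⟨Finset.card_filter_le _ _, ?_⟩
  have h1 := Finset.card_filter_add_card_filter_not (s := Nat.primesLE X) (fun p => p ∣ 3 * m)
  have h2 : ((Nat.primesLE X).filter (fun p => p ∣ 3 * m)).card ≤ 3 * m :=
    calc _ ≤ (3 * m).divisors.card := Finset.card_le_card (fun p hp => by
            simp only [Finset.mem_filter, Nat.mem_primesLE] at hp
            exact Nat.mem_divisors.mpr ⟨hp.2, by omega⟩)
      _ ≤ 3 * m := Nat.card_divisors_le_self _
  omega

/-- **Fibre count.** The escape set of `DegreeOnePrimesEscape` for a subgroup `H` maps under the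
norm into the good primes escaping `H` together with the `≤ 3m` primes dividing `3m`, with fibres of
size `≤ 3` (at most three prime ideals of each prime norm). -/
theorem ncard_escapeSet_le (K : Type) [Field K] [NumberField K] (X m : ℕ) (hm : m ≠ 0)
    (hfib : ∀ p : ℕ, p.Prime → {P : Ideal (𝓞 K) | P.IsPrime ∧ Ideal.absNorm P = p}.ncard ≤ 3)
    (H : Subgroup (ClassGroup (𝓞 K))) :
    {P : Ideal (𝓞 K) | P.IsPrime ∧ (Ideal.absNorm P).Prime ∧ Ideal.absNorm P ≤ X ∧
        ∃ hP : P ∈ nonZeroDivisors (Ideal (𝓞 K)), ClassGroup.mk0 ⟨P, hP⟩ ∉ H}.ncard ≤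
      3 * (Nat.card {p : {p : ℕ // p.Prime ∧ p ≤ X ∧ ¬ p ∣ 3 * m} //
              ∃ P : Ideal (𝓞 K), ∃ hP : P ∈ nonZeroDivisors (Ideal (𝓞 K)),
                P.IsPrime ∧ Ideal.absNorm P = (p : ℕ) ∧ ClassGroup.mk0 ⟨P, hP⟩ ∉ H} + 3 * m) := by
  classical
  set F := {P : Ideal (𝓞 K) | P.IsPrime ∧ (Ideal.absNorm P).Prime ∧ Ideal.absNorm P ≤ X ∧
        ∃ hP : P ∈ nonZeroDivisors (Ideal (𝓞 K)), ClassGroup.mk0 ⟨P, hP⟩ ∉ H}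
  have hFfin : F.Finite :=
    (Ideal.finite_setOf_absNorm_le (S := 𝓞 K) X).subset (by rintro P ⟨-, -, h, -⟩; exact h)
  set E : Finset ℕ := (Nat.primesLE X).filter (fun p => ¬ p ∣ 3 * m ∧
      ∃ P : Ideal (𝓞 K), ∃ hP : P ∈ nonZeroDivisors (Ideal (𝓞 K)),
        P.IsPrime ∧ Ideal.absNorm P = p ∧ ClassGroup.mk0 ⟨P, hP⟩ ∉ H) with hE
  have hEcard : Nat.card {p : {p : ℕ // p.Prime ∧ p ≤ X ∧ ¬ p ∣ 3 * m} //
      ∃ P : Ideal (𝓞 K), ∃ hP : P ∈ nonZeroDivisors (Ideal (𝓞 K)),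
        P.IsPrime ∧ Ideal.absNorm P = (p : ℕ) ∧ ClassGroup.mk0 ⟨P, hP⟩ ∉ H} = E.card := by
    rw [Nat.card_congr (Equiv.subtypeSubtypeEquivSubtypeInter
      (fun p : ℕ => p.Prime ∧ p ≤ X ∧ ¬ p ∣ 3 * m)
      (fun p : ℕ => ∃ P : Ideal (𝓞 K), ∃ hP : P ∈ nonZeroDivisors (Ideal (𝓞 K)),
        P.IsPrime ∧ Ideal.absNorm P = p ∧ ClassGroup.mk0 ⟨P, hP⟩ ∉ H))]
    refine Nat.subtype_card E (fun p => ?_)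
    simp only [hE, Finset.mem_filter, Nat.mem_primesLE]
    tauto
  have himage : hFfin.toFinset.image Ideal.absNorm ⊆ E ∪ (3 * m).divisors := by
    intro a ha
    obtain ⟨P, hP, rfl⟩ := Finset.mem_image.mp ha
    obtain ⟨h1, h2, h3, hP0, h4⟩ := (Set.Finite.mem_toFinset hFfin).mp hP
    by_cases hdvd : Ideal.absNorm P ∣ 3 * m
    · exact Finset.mem_union_right _ (Nat.mem_divisors.mpr ⟨hdvd, by omega⟩)
    · exact Finset.mem_union_left _
        (Finset.mem_filter.mpr ⟨Nat.mem_primesLE.mpr ⟨h3, h2⟩, hdvd, P, hP0, h1, rfl, h4⟩)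
  have hfibre : ∀ a ∈ hFfin.toFinset.image Ideal.absNorm,
      (hFfin.toFinset.filter (fun P => Ideal.absNorm P = a)).card ≤ 3 := by
    intro a ha
    obtain ⟨P, hP, rfl⟩ := Finset.mem_image.mp ha
    obtain ⟨-, h2, -, -⟩ := (Set.Finite.mem_toFinset hFfin).mp hP
    rw [← Set.ncard_coe_finset]
    refine (Set.ncard_le_ncard ?_ ((Ideal.finite_setOf_absNorm_eq (S := 𝓞 K)
      (Ideal.absNorm P)).subset fun Q hQ => hQ.2)).trans (hfib _ h2)
    intro Q hQ
    obtain ⟨hQF, hQa⟩ := Finset.mem_filter.mp (Finset.mem_coe.mp hQ)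
    exact ⟨((Set.Finite.mem_toFinset hFfin).mp hQF).1, hQa⟩
  rw [Set.ncard_eq_toFinset_card _ hFfin]
  calc hFfin.toFinset.card ≤ 3 * (hFfin.toFinset.image Ideal.absNorm).card :=
        Finset.card_le_mul_card_image _ 3 hfibre
    _ ≤ 3 * (E ∪ (3 * m).divisors).card := Nat.mul_le_mul_left _ (Finset.card_le_card himage)
    _ ≤ 3 * (E.card + (3 * m).divisors.card) := Nat.mul_le_mul_left _ (Finset.card_union_le _ _)
    _ ≤ _ := by
        rw [hEcard]
        exact Nat.mul_le_mul_left _ (Nat.add_le_add_left (Nat.card_divisors_le_self _) _)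

/-- **Union bound over proper subgroups.** If for every proper subgroup `H` of a finite group `G`
at most `D` sample points `ω` have all their group elements `Xs ω` inside `H`, then among the
`T`-tuples of sample points at most `#{subgroups of G} · D^T` fail to generate `G` (the subgroup
generated is proper and contains every `Xs (w t)`). (Folklore; cf. Cheung–Mosca 2001 §3.) -/
theorem card_closure_ne_top_le {G : Type*} [Group G] [Finite G] {Ω : Type*} [Finite Ω]
    (T D : ℕ) (Xs : Ω → Set G) (gen : (Fin T → Ω) → Set G)
    (hgen : ∀ w t, Xs (w t) ⊆ gen w)
    (hD : ∀ H : Subgroup G, H ≠ ⊤ → Nat.card {ω : Ω // Xs ω ⊆ H} ≤ D) :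
    Nat.card {w : Fin T → Ω // Subgroup.closure (gen w) ≠ ⊤} ≤ Nat.card (Subgroup G) * D ^ T := by
  classical
  haveI := Fintype.ofFinite Ω
  haveI : Finite (Subgroup G) := Literature.Computability.Cryptography.Hallgren2005.finite_subgroup
  haveI := Fintype.ofFinite (Subgroup G)
  rw [Nat.card_eq_fintype_card, Fintype.card_subtype, Nat.card_eq_fintype_card]
  set bad : Subgroup G → Finset (Fin T → Ω) :=
    fun H => Fintype.piFinset fun _ => Finset.univ.filter (fun ω => Xs ω ⊆ H) with hbad
  have hcover : (Finset.univ.filter fun w : Fin T → Ω => Subgroup.closure (gen w) ≠ ⊤) ⊆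
      (Finset.univ.filter fun H : Subgroup G => H ≠ ⊤).biUnion bad := by
    intro w hw
    simp only [Finset.mem_filter, Finset.mem_univ, true_and] at hw
    simp only [Finset.mem_biUnion, Finset.mem_filter, Finset.mem_univ, true_and, hbad,
      Fintype.mem_piFinset]
    exact ⟨_, hw, fun t => (hgen w t).trans Subgroup.subset_closure⟩
  have hbadle : ∀ H ∈ Finset.univ.filter (fun H : Subgroup G => H ≠ ⊤), (bad H).card ≤ D ^ T := by
    intro H hH
    simp only [Finset.mem_filter, Finset.mem_univ, true_and] at hH
    rw [hbad, Fintype.card_piFinset_const]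
    refine Nat.pow_le_pow_left ?_ T
    have := hD H hH
    rwa [Nat.card_eq_fintype_card, Fintype.card_subtype] at this
  calc (Finset.univ.filter fun w : Fin T → Ω => Subgroup.closure (gen w) ≠ ⊤).card
      ≤ ((Finset.univ.filter fun H : Subgroup G => H ≠ ⊤).biUnion bad).card :=
        Finset.card_le_card hcover
    _ ≤ ∑ H ∈ Finset.univ.filter (fun H : Subgroup G => H ≠ ⊤), (bad H).card :=
        Finset.card_biUnion_le
    _ ≤ ∑ _H ∈ Finset.univ.filter (fun H : Subgroup G => H ≠ ⊤), D ^ T :=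
        Finset.sum_le_sum hbadle
    _ = (Finset.univ.filter (fun H : Subgroup G => H ≠ ⊤)).card * D ^ T := by
        rw [Finset.sum_const, smul_eq_mul]
    _ ≤ Fintype.card (Subgroup G) * D ^ T :=
        Nat.mul_le_mul_right _ (Finset.card_filter_le _ _)

/-! ## The stub -/

/-- **S4b `stub_generation`** (line `arakelov-giant-step-cycle`). From the elementary pure-cubic
facts (S4a, the first hypothesis: no quadratic subfield, `|d_K| ≤ 27 m²`, `h_K ≤ (27 m²)^10`, at
most `3` prime ideals of each prime norm) and `DegreeOnePrimesEscape` at `n = 3`: there is `C` such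
that for every cubic `K ∋ ∛m` (`m` a non-cube) and `X ≥ (27 m²)^C` — (i) DENSITY: the good primes
`p ≤ X, p ∤ 3m` number `≥ X / (4 (⌊log₂ X⌋ + 1))` (Chebyshev); (ii) GENERATION: for
`T ≥ 600 (⌊log₂ X⌋ + 1)²`, all but a fraction `≤ 1/8` of the `T`-tuples of good primes have the
property that the classes of ALL degree-one primes above them generate `Cl(𝓞 K)` (union bound over
the proper subgroup generated, `≤ (h+1)^{⌊log₂ h⌋}` subgroups, each escaped by `≥ N/25` of the `N`
good primes). We take `C = max C₃ 4`, `C₃` the constant of `DegreeOnePrimesEscape` at `n = 3`. -/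
theorem stub_generation :
    (∀ m : ℕ, (∀ r : ℕ, r ^ 3 ≠ m) →
      (∃ (K : Type) (_ : Field K) (_ : NumberField K), Module.finrank ℚ K = 3 ∧ ∃ α : K, α ^ 3 = (m : K)) ∧
      ∀ (K : Type) [Field K] [NumberField K], Module.finrank ℚ K = 3 → (∃ α : K, α ^ 3 = (m : K)) →
        (∀ F : IntermediateField ℚ K, Module.finrank ℚ F ≠ 2) ∧
        |NumberField.discr K| ≤ 27 * (m : ℤ) ^ 2 ∧
        NumberField.classNumber K ≤ (27 * m ^ 2) ^ 10 ∧
        ∀ p : ℕ, p.Prime → {P : Ideal (𝓞 K) | P.IsPrime ∧ Ideal.absNorm P = p}.ncard ≤ 3) →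
    DegreeOnePrimesEscape → ∃ C : ℕ, ∀ (K : Type) [Field K] [NumberField K],
    Module.finrank ℚ K = 3 → ∀ m : ℕ, (∀ r : ℕ, r ^ 3 ≠ m) → (∃ α : K, α ^ 3 = (m : K)) →
    ∀ X : ℕ, (27 * m ^ 2) ^ C ≤ X →
      X ≤ 4 * (Nat.log 2 X + 1) * Nat.card {p : ℕ // p.Prime ∧ p ≤ X ∧ ¬ p ∣ 3 * m} ∧
      ∀ T : ℕ, 600 * (Nat.log 2 X + 1) ^ 2 ≤ T →
        8 * Nat.card {v : Fin T → {p : ℕ // p.Prime ∧ p ≤ X ∧ ¬ p ∣ 3 * m} //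
            Subgroup.closure {c : ClassGroup (𝓞 K) | ∃ i : Fin T, ∃ P : Ideal (𝓞 K),
              ∃ hP : P ∈ nonZeroDivisors (Ideal (𝓞 K)),
                P.IsPrime ∧ Ideal.absNorm P = (v i : ℕ) ∧ c = ClassGroup.mk0 ⟨P, hP⟩} ≠ ⊤} ≤
          Nat.card {p : ℕ // p.Prime ∧ p ≤ X ∧ ¬ p ∣ 3 * m} ^ T := by
  intro hfacts hEsc
  obtain ⟨C₃, hC₃⟩ := hEsc 3
  refine ⟨max C₃ 4, ?_⟩
  intro K _ _ hdeg m hm hα X hX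
  obtain ⟨hnoquad, hdisc, hclass, hfib⟩ := (hfacts m hm).2 K hdeg hα
  -- `m ≥ 2` since `0` and `1` are cubes
  have hm2 : 2 ≤ m := by
    rcases Nat.lt_or_ge m 2 with h | h
    · interval_cases m
      · exact absurd rfl (hm 0)
      · exact absurd rfl (hm 1)
    · exact h
  have hm0 : m ≠ 0 := by omega
  -- the base `27 m² ≥ 64` and the logarithms
  have hB64 : 2 ^ 6 ≤ 27 * m ^ 2 := by nlinarith [hm2]
  have hB0 : 27 * m ^ 2 ≠ 0 := by positivity
  have hC4 : 4 ≤ max C₃ 4 := le_max_right _ _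
  have hBX : 27 * m ^ 2 ≤ X :=
    calc 27 * m ^ 2 = (27 * m ^ 2) ^ 1 := (pow_one _).symm
      _ ≤ (27 * m ^ 2) ^ max C₃ 4 := Nat.pow_le_pow_right (by omega) (by omega)
      _ ≤ X := hX
  have hX0 : X ≠ 0 := by omega
  have hb6 : 6 ≤ Nat.log 2 (27 * m ^ 2) := Nat.le_log_of_pow_le one_lt_two hB64
  have hL6 : 6 ≤ Nat.log 2 X := Nat.le_log_of_pow_le one_lt_two (hB64.trans hBX)
  have hLb : max C₃ 4 * Nat.log 2 (27 * m ^ 2) ≤ Nat.log 2 X := by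
    refine Nat.le_log_of_pow_le one_lt_two ?_
    calc 2 ^ (max C₃ 4 * Nat.log 2 (27 * m ^ 2)) = (2 ^ Nat.log 2 (27 * m ^ 2)) ^ max C₃ 4 := by
          rw [mul_comm, pow_mul]
      _ ≤ (27 * m ^ 2) ^ max C₃ 4 := Nat.pow_le_pow_left (Nat.pow_log_le_self 2 hB0) _
      _ ≤ X := hX
  -- Chebyshev: `π(X) ≥ 1800 m`
  have hcheb := le_log_succ_mul_primeCounting_succ X
  have hπ : 1800 * m ≤ Nat.primeCounting X := by
    have h1 : (Nat.log 2 X + 1) * (Nat.log 2 X + 1) ≤ X :=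
      (succ_sq_le_two_pow hL6).trans (Nat.pow_log_le_self 2 hX0)
    have h2 : (1800 * m + 1) * (1800 * m + 1) ≤ X := by
      have h8 : 8 * m ≤ m ^ 4 :=
        calc 8 * m = 2 ^ 3 * m := by norm_num
          _ ≤ m ^ 3 * m := Nat.mul_le_mul_right _ (Nat.pow_le_pow_left hm2 3)
          _ = m ^ 4 := by ring
      have h3 : 1800 * m + 1 ≤ (27 * m ^ 2) ^ 2 := by nlinarith [h8, hm2]
      calc (1800 * m + 1) * (1800 * m + 1) ≤ (27 * m ^ 2) ^ 2 * (27 * m ^ 2) ^ 2 :=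
            Nat.mul_le_mul h3 h3
        _ = (27 * m ^ 2) ^ 4 := by ring
        _ ≤ (27 * m ^ 2) ^ max C₃ 4 := Nat.pow_le_pow_right (by omega) hC4
        _ ≤ X := hX
    have key : (Nat.log 2 X + 1) * (1800 * m + 1) ≤
        (Nat.log 2 X + 1) * (Nat.primeCounting X + 1) := by
      rcases le_total (Nat.log 2 X + 1) (1800 * m + 1) with h | h
      · exact ((Nat.mul_le_mul_right _ h).trans h2).trans hcheb
      · exact ((Nat.mul_le_mul_left _ h).trans h1).trans hcheb
    have := Nat.le_of_mul_le_mul_left key (Nat.succ_pos _)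
    omega
  obtain ⟨hNle, hNge⟩ := card_goodPrimes X m hm0
  refine ⟨?_, fun T hT => ?_⟩
  · -- (i) density
    have h4 : Nat.primeCounting X + 1 ≤ 4 * Nat.card {p : ℕ // p.Prime ∧ p ≤ X ∧ ¬ p ∣ 3 * m} := by
      omega
    calc X ≤ (Nat.log 2 X + 1) * (Nat.primeCounting X + 1) := hcheb
      _ ≤ (Nat.log 2 X + 1) * (4 * Nat.card {p : ℕ // p.Prime ∧ p ≤ X ∧ ¬ p ∣ 3 * m}) :=
          Nat.mul_le_mul_left _ h4
      _ = _ := by ring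
  -- (ii) generation
  haveI : Finite {p : ℕ // p.Prime ∧ p ≤ X ∧ ¬ p ∣ 3 * m} :=
    Finite.of_injective (fun p => (⟨p.1, Nat.lt_succ_of_le p.2.2.1⟩ : Fin (X + 1)))
      fun a b h => Subtype.ext (Fin.val_eq_of_eq h)
  have hdiscX : |NumberField.discr K| ^ C₃ ≤ (X : ℤ) :=
    calc |NumberField.discr K| ^ C₃ ≤ (27 * (m : ℤ) ^ 2) ^ C₃ :=
          pow_le_pow_left₀ (abs_nonneg _) hdisc C₃
      _ = (((27 * m ^ 2) ^ C₃ : ℕ) : ℤ) := by push_cast; ring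
      _ ≤ (((27 * m ^ 2) ^ max C₃ 4 : ℕ) : ℤ) := by
          exact_mod_cast Nat.pow_le_pow_right (by omega) (le_max_left _ _)
      _ ≤ X := by exact_mod_cast hX
  -- escape: for a proper `H`, at most `24N/25` good primes have all degree-one classes in `H`
  have hD : ∀ H : Subgroup (ClassGroup (𝓞 K)), H ≠ ⊤ →
      Nat.card {p : {p : ℕ // p.Prime ∧ p ≤ X ∧ ¬ p ∣ 3 * m} //
        {c : ClassGroup (𝓞 K) | ∃ P : Ideal (𝓞 K), ∃ hP : P ∈ nonZeroDivisors (Ideal (𝓞 K)),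
          P.IsPrime ∧ Ideal.absNorm P = (p : ℕ) ∧ c = ClassGroup.mk0 ⟨P, hP⟩} ⊆
          (H : Set (ClassGroup (𝓞 K)))} ≤
      24 * Nat.card {p : ℕ // p.Prime ∧ p ≤ X ∧ ¬ p ∣ 3 * m} / 25 := by
    intro H hH
    classical
    have hsplit := (Nat.card_sum ..).symm.trans (Nat.card_congr (Equiv.sumCompl
      fun p : {p : ℕ // p.Prime ∧ p ≤ X ∧ ¬ p ∣ 3 * m} =>
        {c : ClassGroup (𝓞 K) | ∃ P : Ideal (𝓞 K), ∃ hP : P ∈ nonZeroDivisors (Ideal (𝓞 K)),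
          P.IsPrime ∧ Ideal.absNorm P = (p : ℕ) ∧ c = ClassGroup.mk0 ⟨P, hP⟩} ⊆
          (H : Set (ClassGroup (𝓞 K)))))
    have he : Nat.card {p : {p : ℕ // p.Prime ∧ p ≤ X ∧ ¬ p ∣ 3 * m} //
        ¬ ({c : ClassGroup (𝓞 K) | ∃ P : Ideal (𝓞 K), ∃ hP : P ∈ nonZeroDivisors (Ideal (𝓞 K)),
          P.IsPrime ∧ Ideal.absNorm P = (p : ℕ) ∧ c = ClassGroup.mk0 ⟨P, hP⟩} ⊆
          (H : Set (ClassGroup (𝓞 K))))} =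
        Nat.card {p : {p : ℕ // p.Prime ∧ p ≤ X ∧ ¬ p ∣ 3 * m} //
          ∃ P : Ideal (𝓞 K), ∃ hP : P ∈ nonZeroDivisors (Ideal (𝓞 K)),
            P.IsPrime ∧ Ideal.absNorm P = (p : ℕ) ∧ ClassGroup.mk0 ⟨P, hP⟩ ∉ H} := by
      refine Nat.card_congr (Equiv.subtypeEquivRight fun p => ⟨fun h => ?_, ?_⟩)
      · by_contra h'
        exact h fun c ⟨P, hP, h1, h2, h3⟩ => h3 ▸ by_contra fun hc => h' ⟨P, hP, h1, h2, hc⟩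
      · rintro ⟨P, hP, h1, h2, h3⟩ h
        exact h3 (h ⟨P, hP, h1, h2, rfl⟩)
    have hcomb : Nat.primeCounting X ≤
        24 * Nat.card {p : {p : ℕ // p.Prime ∧ p ≤ X ∧ ¬ p ∣ 3 * m} //
          ∃ P : Ideal (𝓞 K), ∃ hP : P ∈ nonZeroDivisors (Ideal (𝓞 K)),
            P.IsPrime ∧ Ideal.absNorm P = (p : ℕ) ∧ ClassGroup.mk0 ⟨P, hP⟩ ∉ H} + 72 * m :=
      calc Nat.primeCounting X ≤ _ := hC₃ K hdeg hnoquad X hdiscX H hH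
        _ ≤ 8 * (3 * (_ + 3 * m)) := Nat.mul_le_mul_left _ (ncard_escapeSet_le K X m hm0 hfib H)
        _ = _ := by ring
    rw [Nat.le_div_iff_mul_le (by norm_num)]
    omega
  have hunion := card_closure_ne_top_le T
    (24 * Nat.card {p : ℕ // p.Prime ∧ p ≤ X ∧ ¬ p ∣ 3 * m} / 25)
    (fun p : {p : ℕ // p.Prime ∧ p ≤ X ∧ ¬ p ∣ 3 * m} =>
      {c : ClassGroup (𝓞 K) | ∃ P : Ideal (𝓞 K), ∃ hP : P ∈ nonZeroDivisors (Ideal (𝓞 K)),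
        P.IsPrime ∧ Ideal.absNorm P = (p : ℕ) ∧ c = ClassGroup.mk0 ⟨P, hP⟩})
    (fun v => {c : ClassGroup (𝓞 K) | ∃ i : Fin T, ∃ P : Ideal (𝓞 K),
      ∃ hP : P ∈ nonZeroDivisors (Ideal (𝓞 K)),
        P.IsPrime ∧ Ideal.absNorm P = (v i : ℕ) ∧ c = ClassGroup.mk0 ⟨P, hP⟩})
    (fun w t => by
      rintro c ⟨P, hP, h1, h2, h3⟩
      exact ⟨t, P, hP, h1, h2, h3⟩) hD
  -- the subgroup count and the final arithmetic
  have hsub := Literature.Computability.Cryptography.Hallgren2005.card_subgroup_le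
    (G := ClassGroup (𝓞 K))
  have hh : Nat.card (ClassGroup (𝓞 K)) ≤ (27 * m ^ 2) ^ 10 := by
    rw [Nat.card_eq_fintype_card]; exact hclass
  have hexp := exponent_le (T := T) hB0 hh
    ((Nat.mul_le_mul_right _ (by omega : 3 ≤ max C₃ 4)).trans hLb) (by omega) hT
  have hfin := eight_mul_pow_log_mul_pow_le _ T hexp
  refine Nat.le_of_mul_le_mul_left ?_ (pow_pos (by norm_num : 0 < 25) T)
  calc 25 ^ T * (8 * _) ≤ 25 ^ T * (8 * (Nat.card (Subgroup (ClassGroup (𝓞 K))) *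
        (24 * Nat.card {p : ℕ // p.Prime ∧ p ≤ X ∧ ¬ p ∣ 3 * m} / 25) ^ T)) :=
        Nat.mul_le_mul_left _ (Nat.mul_le_mul_left _ hunion)
    _ = 8 * Nat.card (Subgroup (ClassGroup (𝓞 K))) *
        (25 * (24 * Nat.card {p : ℕ // p.Prime ∧ p ≤ X ∧ ¬ p ∣ 3 * m} / 25)) ^ T := by ring
    _ ≤ 8 * (Nat.card (ClassGroup (𝓞 K)) + 1) ^ Nat.log 2 (Nat.card (ClassGroup (𝓞 K))) *
        (24 * Nat.card {p : ℕ // p.Prime ∧ p ≤ X ∧ ¬ p ∣ 3 * m}) ^ T :=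
        Nat.mul_le_mul (Nat.mul_le_mul_left _ hsub) (Nat.pow_le_pow_left (Nat.mul_div_le _ _) T)
    _ = 8 * (Nat.card (ClassGroup (𝓞 K)) + 1) ^ Nat.log 2 (Nat.card (ClassGroup (𝓞 K))) *
        24 ^ T * Nat.card {p : ℕ // p.Prime ∧ p ≤ X ∧ ¬ p ∣ 3 * m} ^ T := by ring
    _ ≤ 25 ^ T * Nat.card {p : ℕ // p.Prime ∧ p ≤ X ∧ ¬ p ∣ 3 * m} ^ T :=
        Nat.mul_le_mul_right _ hfin

end Summit.QuantumAdvantage.QuantumAdvantage.Theorems.LinnikCubicClassGroups
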